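import Summits.QuantumFields.YangMills.Theorems.BalabanUVNodesN16H7OfN07RecordSlot
import Summits.QuantumFields.YangMills.Theorems.BalabanUVNodesN16H7LooseOfReg910Slot
import HarnessLib

/-!
# Route «BalabanUVNodes» (K3⁷ `SpineGivenEndpointR13SepCoPH`, stmt-QuantumFields-20544), DAG node N16 = NE3, in-edge N07 → N16 — THE (0.4) → (42) TRANSFER RE-KEYED AT THE
# SLOT CUBES: `Thm1AtTransfer04toSlot` (consequent = the SLOT KEY (T9ˢ) ∧ (T8) of `…N16H7LooseOfReg910Slot`, not the refuted all-cube torus reading), the old transfer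
# implies it, and node N07's slot of record `B11Leaf (Z11OfRecord F N ζ)` ⟹ node N16's loose leaf through it

Cell `pub-ymgap`, width seat `pub-ymgap-dag-n16-w1` (director-ym №197 ∕ HUMAN RULING D-0149), generation 5, file 10 of this lineage — the slot-keyed successor of file 3
(`…N16H7OfN07RecordSlot` p588364, definition lane: `lipGauge`, `Thm1AtTransfer04to42`).  `--supports stmt-QuantumFields-20544 --as helper` (count-neutral; ONE `def` = a
displayed hypothesis SHAPE, no object of Bałaban's constructed).  `bears_on: R4∕N16 · edge N07 → N16`.

WHY.  File 3's transfer `Thm1AtTransfer04to42 F N ζ B` has as CONSEQUENT `∃ C', C'.B₃ ≤ B ∧ (M(e) ≥ 7∕2) ∧ ∀ k, Thm1At C' (torusVP 4 F.L Nper (lipGauge 4 (Fin N)) (k+1))` —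
[Balaban1985Variational] Theorem 1 read at leaf-06's torus instances on ALL lattice cubes (divergence D-s3-3).  dag-n16-w2 g4 (`…N16Thm1AtTorusVPSmallCubes` p608145,
`not_forall_thm1At_torusVP`; INTENT-4 `…SmallCubesConsequences`) certifies that consequent FALSE at rank two, so there the transfer collapses to `¬`(its antecedent) and the pair
«`B11Leaf (Z11OfRecord F 2 ζ)` ∧ transfer» displayed by file 3 §3 and by dag-n16-e's module 46 (`…N16PinnedLooseMatchOfN07Slot` p606647) is UNINHABITED (chair A6).  The
N16 loose road reads of that consequent only the SLOT KEY (file 9 `…N16H7LooseOfReg910Slot` §1): (T9ˢ) (9)–(10) at the (8)-class minimisers on the collar-slot cubes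
`(x, F.L^{k+1} − 1 + F.L^{k+1} + 2)` and (T8) existence of those minimisers.  This file re-targets the transfer at exactly that.

WHAT THIS FILE DECLARES ∕ PROVES (kernel; 1 `def` + theorems, 0 `sorry`).
* §1 `Thm1AtTransfer04toSlot F N ζ B` (def, a `Prop`, asserted for NOTHING): ANTECEDENT = file 3's (Theorem 1 at NODE 00's (0.4)-objects over print's family index, what
  `Node00.exists_thm1At_of_b11Leaf_Z11OfRecord` delivers from N07's slot); CONSEQUENT = `∃ C', C'.B₃ ≤ B ∧` (T9ˢ) `∧` (T8) at `(4, F.L, ne3NperOfRecord₁₁ F 0 0, lipGauge 4 (Fin N), C')`.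
  `thm1AtTransfer04toSlot_iff` (unfolding); ★ `thm1AtTransfer04toSlot_of_04to42` (the OLD transfer implies the NEW — file 9 §1's projections; so every consumer re-keyed
  here is weaker-keyed); `slotKey_of_b11Leaf_Z11OfRecord_of_transferSlot` (N07's slot ∧ the new transfer ⟹ the slot key `∃ C', B₃ ≤ B ∧ (T9ˢ) ∧ (T8)` — the one-line
  unpacking dag-n16-e's module 46 re-keys over).
* §2 ★ `h7Shape_loose_of_b11Leaf_Z11OfRecord_of_transferSlot` — file 3 §3's first theorem VERBATIM IN CONCLUSION (`∃ C ε₀, … LeafH3sup 4 F.L Nper ε (Cε) (Cε)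
  {V ∈ ne3DomOfRecord₁₁ F N 0 0 | V ∈ sfClass 4 F.L Nper (ε∕B) 0}`) from `B11Leaf (Z11OfRecord F N ζ)` and the NEW transfer: file 9 §2 `leafH3sup_loose_of_reg910Slot` at
  `lipGauge` (`radiiMono_lipGauge'`, `interface_lipGauge'`) ∘ `sfClass_mono`.  File 3 §3's second theorem (the tight-window leaf AP-N16-2) is NOT re-keyed: that leaf is
  model-false (file 5 `…N16H7Fronts`, evidence #27∕#28) and off the road of record ((β16) LOOSE, plan g82 WORDS-2).

HONEST FRAMING.  A displayed hypothesis SHAPE between two typings of the tree + bookkeeping BY NAME; the new transfer is WEAKER than file 3's and NOT refuted by p608145, but it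
is [Balaban1987RG1] p. 253∕254's universality claim specialised to [Balaban1985Variational] Theorem 1 (context: Thm 1 (8)–(10) p. 279) — PRINT'S CLAIM, proved nowhere in
the tree, asserted for nothing here; it still hides this lineage's located items A1 (plaquette-only class) and D-s3-2 (global minimum).  Nothing of Bałaban asserted or
refuted; `stub_h7` NOT closed; no stub of K3⁷ v5 named or closed; N16 ∕ N07 NOT discharged; count-neutral; counts of record unmoved (typed 28∕28 · discharged 5∕28);
one finite four-torus at fixed `ε`, Bałaban AS PRINTED — NOT ℝ⁴, NOT infinite volume, NOT OS, NOT a mass gap; the YM mass gap (Clay) is NOT proved by any of this — R4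
closes the conditional finite-𝕋⁴ rung `BalabanLadder.UV` only.
-/

set_option autoImplicit false

open scoped BigOperators Matrix Matrix.Norms.L2Operator
open NormedSpace

namespace Summit.QuantumFields.YangMills.BalabanUVNodes.N16H7OfN07RecordSlotKey

open Literature.MathematicalPhysics.QuantumFieldTheory.Balaban1983to89
open B7Prop1Explicit B7Prop2Explicit MatrixLog UnitaryModel
open T4AveragingDeficitWall hiding Site Plane Plaq Bond
open T4Continuum (T4Family)
open Summit.QuantumFields.BalabanUV.T4Continuum
open MinimalActionSandwich (IsMinimiser)
open MinimalActionRate (sfClass)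
open MinimalActionDictionary (torusVP RadiiMono sfClass_mono)
open NE3.LeafIndexSockets (LeafH3sup)
open B11 (Regularity)
open B11Thm1 (Thm1At)
open B11Thm1CarrierT (varProblemT)
open DagBinding (B11Leaf)
open Node00 (ne3NperOfRecord₁₁ ne3DomOfRecord₁₁ MatA ZIdx ResidZ Z11OfRecord exists_thm1At_of_b11Leaf_Z11OfRecord)
open Summit.QuantumFields.YangMills.BalabanUVNodes.N16H7OfReg9 (leafH3sup_mono leafH3sup_anti)
open Summit.QuantumFields.YangMills.BalabanUVNodes.N16H7OfN07RecordSlot (lipGauge Thm1AtTransfer04to42 radiiMono_lipGauge' interface_lipGauge')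
open Summit.QuantumFields.YangMills.BalabanUVNodes.N16H7LooseOfReg910Slot (reg910Slot_of_thm1At_torusVP exists8Min_of_thm1At_torusVP leafH3sup_loose_of_reg910Slot)

noncomputable section

/-! ## §1 The transfer (0.4) → (42) with the SLOT KEY as consequent — ONE displayed hypothesis -/

section Transfer

variable (F : T4Family) (N : ℕ) [NeZero N]

/-- **THE AVERAGING TRANSFER (0.4) → (42) AT THE SLOT KEY** (a `Prop`; asserted for NOTHING — [Balaban1987RG1] p. 253∕254's universality claim specialised to
[Balaban1985Variational] Theorem 1, stated between two typings of the tree; the slot-keyed successor of file 3's `Thm1AtTransfer04to42`).  ANTECEDENT (file 3's, verbatim)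
= Theorem 1 AT NODE 00's (0.4)-OBJECTS over print's family index (`varProblemT F N i.K i.k (ζ.R i)`, all `i : ZIdx`) — what node N07's slot `B11Leaf (Z11OfRecord F N ζ)`
delivers through `Node00.exists_thm1At_of_b11Leaf_Z11OfRecord`.  CONSEQUENT = constants `C'` with (8)-radius constant `C'.B₃ ≤ B` (the displayed letter) and, at node N16's
record letters (`d = 4`, `L = F.L`, `Nper = ne3NperOfRecord₁₁ F 0 0`, local-gauge shape `lipGauge`, every run `k+1`): (T9ˢ) for every `0 < ε₁ ≤ C'.a₁`, every datum
`V ∈ sfClass 4 F.L Nper ε₁ 0` ((7)), every minimiser `U` of the Wilson action over the (8)-class `sfClass 4 F.L Nper (C'.B₃·ε₁) (k+1)` at `V`, and every site `x`, r2's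
`B11.Regularity` ((9)–(10) in some gauge) on the collar-slot cube `(x, F.L^{k+1} − 1 + F.L^{k+1} + 2)` of leaf-06's `torusVP`; (T8) such a minimiser exists at every such
datum.  WHAT IT HIDES (unchanged from file 3): A1 (plaquette-only class on the (42) side), D-s3-2 (global minimum); no comparison theorem between (0.4)- and
(42)-constrained minimisers is in print or in the tree.  Context: [Balaban1987RG1] pp. 253–254, [Balaban1985Variational] Thm 1 (8)–(10) p. 279. [folklore] -/
@[folklore]
def Thm1AtTransfer04toSlot (ζ : ResidZ F N) (B : ℝ) : Prop :=
  (∃ C : B11Thm1.Consts, ∀ i : ZIdx, Thm1At C (varProblemT F N i.K i.k (ζ.R i))) →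
    ∃ C' : B11Thm1.Consts, C'.B₃ ≤ B ∧
      (∀ (k : ℕ) (ε₁ : ℝ), 0 < ε₁ → ε₁ ≤ C'.a₁ → ∀ (V U : Site 4 → Fin 4 → (MatA N)ˣ), V ∈ sfClass 4 F.L (ne3NperOfRecord₁₁ F 0 0) ε₁ 0 →
        IsMinimiser 4 (sfClass 4 F.L (ne3NperOfRecord₁₁ F 0 0) (C'.B₃ * ε₁)) F.L (ne3NperOfRecord₁₁ F 0 0) (k + 1) V U →
          ∀ x : Site 4, Regularity (torusVP 4 F.L (ne3NperOfRecord₁₁ F 0 0) (lipGauge 4 (Fin N)) (k + 1)) C'.B₃ C'.B₄ ε₁ U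
            (x, F.L ^ (k + 1) - 1 + F.L ^ (k + 1) + 2)) ∧
      (∀ (k : ℕ) (ε₁ : ℝ), 0 < ε₁ → ε₁ ≤ C'.a₁ → ∀ V : Site 4 → Fin 4 → (MatA N)ˣ, V ∈ sfClass 4 F.L (ne3NperOfRecord₁₁ F 0 0) ε₁ 0 →
        ∃ U : Site 4 → Fin 4 → (MatA N)ˣ, IsMinimiser 4 (sfClass 4 F.L (ne3NperOfRecord₁₁ F 0 0) (C'.B₃ * ε₁)) F.L (ne3NperOfRecord₁₁ F 0 0) (k + 1) V U)

/-- The slot-keyed transfer unfolds to its body. [folklore] -/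
theorem thm1AtTransfer04toSlot_iff (ζ : ResidZ F N) (B : ℝ) :
    Thm1AtTransfer04toSlot F N ζ B ↔
      ((∃ C : B11Thm1.Consts, ∀ i : ZIdx, Thm1At C (varProblemT F N i.K i.k (ζ.R i))) →
        ∃ C' : B11Thm1.Consts, C'.B₃ ≤ B ∧
          (∀ (k : ℕ) (ε₁ : ℝ), 0 < ε₁ → ε₁ ≤ C'.a₁ → ∀ (V U : Site 4 → Fin 4 → (MatA N)ˣ), V ∈ sfClass 4 F.L (ne3NperOfRecord₁₁ F 0 0) ε₁ 0 →
            IsMinimiser 4 (sfClass 4 F.L (ne3NperOfRecord₁₁ F 0 0) (C'.B₃ * ε₁)) F.L (ne3NperOfRecord₁₁ F 0 0) (k + 1) V U →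
              ∀ x : Site 4, Regularity (torusVP 4 F.L (ne3NperOfRecord₁₁ F 0 0) (lipGauge 4 (Fin N)) (k + 1)) C'.B₃ C'.B₄ ε₁ U
                (x, F.L ^ (k + 1) - 1 + F.L ^ (k + 1) + 2)) ∧
          (∀ (k : ℕ) (ε₁ : ℝ), 0 < ε₁ → ε₁ ≤ C'.a₁ → ∀ V : Site 4 → Fin 4 → (MatA N)ˣ, V ∈ sfClass 4 F.L (ne3NperOfRecord₁₁ F 0 0) ε₁ 0 →
            ∃ U : Site 4 → Fin 4 → (MatA N)ˣ, IsMinimiser 4 (sfClass 4 F.L (ne3NperOfRecord₁₁ F 0 0) (C'.B₃ * ε₁)) F.L (ne3NperOfRecord₁₁ F 0 0) (k + 1) V U)) :=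
  Iff.rfl

/-- **★ THE OLD TRANSFER IMPLIES THE NEW ONE**: file 3's `Thm1AtTransfer04to42 F N ζ B` (consequent: Theorem 1 at the torus instances on ALL cubes, `M(e) ≥ 7∕2`) implies
`Thm1AtTransfer04toSlot F N ζ B` — same antecedent, and the old consequent projects onto the slot key (file 9 §1 `reg910Slot_of_thm1At_torusVP`, `exists8Min_of_thm1At_torusVP`).
So the new transfer is the WEAKER displayed hypothesis; at rank two the old one is `¬`(antecedent) (dag-n16-w2 INTENT-4), the new one is not known to be.
[cite: Balaban1985Variational, Thm 1 (8)–(10) p.279] -/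
theorem thm1AtTransfer04toSlot_of_04to42 (ζ : ResidZ F N) (B : ℝ) (h : Thm1AtTransfer04to42 F N ζ B) : Thm1AtTransfer04toSlot F N ζ B := by
  intro hant
  obtain ⟨C', hB₃, hM, hT⟩ := h hant
  have hL1 : 1 ≤ F.L := le_of_lt F.hL.2
  exact ⟨C', hB₃, reg910Slot_of_thm1At_torusVP hL1 C' hM hT, exists8Min_of_thm1At_torusVP C' hT⟩

end Transfer

/-! ## §2 Node N07's slot of record ⟹ the slot key ⟹ node N16's loose leaf, modulo the NEW transfer -/

section Edge

variable {N : ℕ} [NeZero N]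

/-- **THE SLOT KEY FROM NODE N07's SLOT OF RECORD AND THE NEW TRANSFER** (the one-line unpacking dag-n16-e's module 46 re-keys over): from `B11Leaf (Z11OfRecord F N ζ)` and
`Thm1AtTransfer04toSlot F N ζ B`, constants `C'` with `C'.B₃ ≤ B`, (T9ˢ) at `(lipGauge 4 (Fin N), C')` and (T8) at `C'` — `Node00.exists_thm1At_of_b11Leaf_Z11OfRecord` feeds the
antecedent.  Both hypotheses displayed; nothing of Bałaban asserted. [cite: Balaban1985Variational, Thm 1 (8)–(10) p.279] -/
theorem slotKey_of_b11Leaf_Z11OfRecord_of_transferSlot (F : T4Family) {ζ : ResidZ F N} (h07 : B11Leaf (Z11OfRecord F N ζ))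
    {B : ℝ} (hT : Thm1AtTransfer04toSlot F N ζ B) :
    ∃ C' : B11Thm1.Consts, C'.B₃ ≤ B ∧
      (∀ (k : ℕ) (ε₁ : ℝ), 0 < ε₁ → ε₁ ≤ C'.a₁ → ∀ (V U : Site 4 → Fin 4 → (MatA N)ˣ), V ∈ sfClass 4 F.L (ne3NperOfRecord₁₁ F 0 0) ε₁ 0 →
        IsMinimiser 4 (sfClass 4 F.L (ne3NperOfRecord₁₁ F 0 0) (C'.B₃ * ε₁)) F.L (ne3NperOfRecord₁₁ F 0 0) (k + 1) V U →
          ∀ x : Site 4, Regularity (torusVP 4 F.L (ne3NperOfRecord₁₁ F 0 0) (lipGauge 4 (Fin N)) (k + 1)) C'.B₃ C'.B₄ ε₁ U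
            (x, F.L ^ (k + 1) - 1 + F.L ^ (k + 1) + 2)) ∧
      (∀ (k : ℕ) (ε₁ : ℝ), 0 < ε₁ → ε₁ ≤ C'.a₁ → ∀ V : Site 4 → Fin 4 → (MatA N)ˣ, V ∈ sfClass 4 F.L (ne3NperOfRecord₁₁ F 0 0) ε₁ 0 →
        ∃ U : Site 4 → Fin 4 → (MatA N)ˣ, IsMinimiser 4 (sfClass 4 F.L (ne3NperOfRecord₁₁ F 0 0) (C'.B₃ * ε₁)) F.L (ne3NperOfRecord₁₁ F 0 0) (k + 1) V U) :=
  hT (exists_thm1At_of_b11Leaf_Z11OfRecord h07)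

/-- **★ NODE N07's SLOT OF RECORD ⟹ NODE N16's LEAF ON LOOSE DATA, BY NAME, MODULO THE NEW TRANSFER** (file 3 §3's `h7Shape_loose_of_b11Leaf_Z11OfRecord_of_transfer` re-keyed,
SAME conclusion): from `B11Leaf (Z11OfRecord F N ζ)` and `Thm1AtTransfer04toSlot F N ζ B`,
`∃ C ε₀, 0 ≤ C ∧ 0 < ε₀ ∧ ∀ ε ∈ ]0,ε₀], LeafH3sup 4 F.L Nper ε (Cε) (Cε) {V ∈ ne3DomOfRecord₁₁ F N 0 0 | V ∈ sfClass 4 F.L Nper (ε∕B) 0}` (`Nper = ne3NperOfRecord₁₁ F 0 0`;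
`C = 16937`, `ε₀ = min(C'.B₃·C'.a₁, 1∕28)`).  Chain: §2's unpacking ∘ file 9 §2 `leafH3sup_loose_of_reg910Slot` at `lipGauge` (`radiiMono_lipGauge'`, `interface_lipGauge'`) ∘
`sfClass_mono` (`ε∕B ≤ ε∕C'.B₃`).  Both hypotheses displayed; nothing of Bałaban asserted. [cite: Balaban1985Variational, Thm 1 (8)–(10) p.279] -/
theorem h7Shape_loose_of_b11Leaf_Z11OfRecord_of_transferSlot (F : T4Family) {ζ : ResidZ F N} (h07 : B11Leaf (Z11OfRecord F N ζ))
    {B : ℝ} (hT : Thm1AtTransfer04toSlot F N ζ B) :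
    ∃ C ε₀ : ℝ, 0 ≤ C ∧ 0 < ε₀ ∧ ∀ ε : ℝ, 0 < ε → ε ≤ ε₀ →
      LeafH3sup 4 F.L (ne3NperOfRecord₁₁ F 0 0) ε (C * ε) (C * ε)
        {V | V ∈ ne3DomOfRecord₁₁ F N 0 0 ∧ V ∈ sfClass 4 F.L (ne3NperOfRecord₁₁ F 0 0) (ε / B) 0} := by
  obtain ⟨C', hB₃, hR, -⟩ := slotKey_of_b11Leaf_Z11OfRecord_of_transferSlot F h07 hT
  have hL1 : 1 ≤ F.L := le_of_lt F.hL.2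
  refine ⟨16937, min (C'.B₃ * C'.a₁) (1 / 28), by norm_num, lt_min (mul_pos C'.B₃_pos C'.a₁_pos) (by norm_num), fun ε hε hεle => ?_⟩
  have h := leafH3sup_loose_of_reg910Slot (d := 4) (n := Fin N) hL1 radiiMono_lipGauge'
    (fun U x K α₀ α₁ α₂ hK hG => interface_lipGauge' U x K α₀ α₁ α₂ hK hG) C' hR hε (hεle.trans (min_le_left _ _))
    (hεle.trans (min_le_right _ _)) (ne3DomOfRecord₁₁ F N 0 0)
  refine leafH3sup_anti (leafH3sup_mono h (by nlinarith) le_rfl) ?_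
  rintro V ⟨hV, hVl⟩
  have hεB : ε / B ≤ ε / C'.B₃ := div_le_div_of_nonneg_left hε.le C'.B₃_pos hB₃
  exact ⟨hV, sfClass_mono hεB hVl⟩

end Edge

end

end Summit.QuantumFields.YangMills.BalabanUVNodes.N16H7OfN07RecordSlotKey
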